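import Summits.QuantumFields.YangMills.Theorems.BalabanUVNodesN18UniformDecayOfStepRate

/-!
# BalabanUVNodes ∕ N18 — THE WINDOWED KERNEL LETTERS FROM THE LIMITING-KERNEL LETTERS UNDER (1.21)-EXISTENCE (ε-room): the two currencies of
# K3⁷'s kernel rows agree up to an arbitrarily small loss in the constants (Track A, DAG node N18 = NE5 `T4OutputRate.NE5`; cluster K4 «SpineRates»;
# key K3⁷ `SpineGivenEndpointR13SepCoPH` = stmt-QuantumFields-20544, skeleton v5 941dddb108cbaacf; width seat `pub-ymgap-dag-n18-w4` g4, FILE 7 of the seat's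
# kernel-currency lineage; `--kind proof --supports stmt-QuantumFields-20544 --as helper`, COUNT-NEUTRAL)

HONEST FRAMING.  Junction lemmas in HYPOTHESIS FORM; `le_of_tendsto`-free ε-room bookkeeping (`Filter.Tendsto` ⟹ eventually within `ε`).  The tree passes
def-W1's WINDOWED finite-volume letters (W1-19b `WindowedStepRate`, `WindowedDecay(Uniform)`, `WindowedNE9`) to the LIMITING-kernel letters (`KernelStepRate`,
`DecayBound (EA …)` ∕ `KernelDecay`, `NE9 (EA …)`) under the (1.21)-existence letter `PolLimitsExist` (dag-n18-w1 `kernelStepRate_of_windowed`, dag-n22-w3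
`decay510_kernelA_of_windowed` ∕ `ne9_EA_of_windowed`).  THIS FILE is the CONVERSE road: under the same existence letter every LIMIT letter gives back the
WINDOWED letter with ANY STRICTLY LARGER constant (the finite-volume kernels are eventually `ε`-close to their limits; `ε` is spent on the constant).  So the
choice of currency for K3⁷'s kernel rows (dag-n27-w1's windowed bill `hS hW h9` vs the limit rows `h18 hdec h22` of dag-n27-c's all-pins bills and of FILE 6's
limit twin) is IMMATERIAL under `hL` up to the constants' ε-room — a structural fact about the crux's displayed inputs, NOT an estimate.  Strictness is
essential: with EQUAL constants the converse is false in general (a vanishing limit difference does not make finite-volume differences vanish).  EVERY letter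
is a DISPLAYED HYPOTHESIS inhabited for no family of record today (K0⁷ OPEN); nothing of Bałaban is asserted; NE5 ∕ NE9 ∕ (5.10) for d = 4 NOT PRINTED as such ∕
NOT proved; N18 ∕ N22 ∕ (D4) NOT discharged; K3⁷ OPEN, not claimed; skeleton v5 UNTOUCHED; counts unmoved (typed 28∕28 · discharged 5∕28).  One finite four-torus
programme at fixed ε — R4 closes the CONDITIONAL rung `BalabanLadder.UV` only; nothing continuum ∕ ℝ⁴ ∕ OS ∕ mass gap ∕ Clay; no summit statement is proved by
this seat.  THEOREMS ONLY: 0 `def`, 0 `sorry`, standard axioms.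

CONTENTS.
§0 ε-room: `eventually_abs_le_add_of_tendsto` · `eventually_abs_sub_le_add_of_tendsto`.
§1 generic term family `ℰ` (W1-19 ∕ W1-19b letters): ★ `windowedStepRate_of_kernelStepRate_of_polLimitsExistBox` (node N18: `KernelStepRate … γ κ θ C₅` + `PolLimitsExistBox … γ`
+ `0 < θ` + `C₅ < C₅'` ⟹ `WindowedStepRate … γ s κ θ (C₅'·θ)` at EVERY run offset `s`) · `windowedStepRate_shift_of_polLimitsExistBox` (one run offset ⟹ every run
offset, up to room) · `windowedDecayUniform_of_decayBound_of_polLimitsExist` ((UD)∕(D4): `DecayBound (EA …) W E₀ κ`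
+ `PolLimitsExist … W` + `E₀ < E₀'` ⟹ W1-19c `WindowedDecayUniform … W E₀' κ`) · `windowedDecay_of_kernelDecay_of_polLimitsExist` (W1-19's per-sequence class ⟹ W1-19b `WindowedDecay`)
· `windowedNE9_of_ne9_EA_of_polLimitsExist` (node N22: `NE9 (EA …) W κ Λ` + `PolLimitsExist … W` + `Λ < Λ'` pointwise ⟹ `WindowedNE9 … W κ Λ'`)
· `baseRowLimit_of_baseRow_of_polLimitsExist` ∕ `baseRow_of_baseRowLimit_of_polLimitsExist` (FILE 6's two level-0 rows agree up to room under `PolLimitsExist`).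
§2 at the record (Stage 13): `windowedStepRateOfRecord₁₃_of_kernelStepRateOfRecord₁₃` · `windowedDecayUniformOfRecord₁₃_of_kernelDecayUniform` · `windowedDecayOfRecord₁₃_of_kernelDecayOfRecord₁₃`
· `windowedNE9OfRecord₁₃_of_ne9`; ★ `kernelStepRateOfRecord₁₃_iff_windowed_upToRoom` (node N18's two letters of record AGREE under `PolLimitsExistOfRecord₁₃`: windowed at `C₅·θ₅` ⟹
limit at `C₅` (dag-n18-w1) and limit at `C₅` ⟹ windowed at `C₅'·θ₅` for every `C₅' > C₅`).

Sources (TYPES only): T. Bałaban, Commun. Math. Phys. **109** (1987) 249–301 [Balaban1987RG1] — Thm 1 p. 259, (1.18) p. 263, (1.20)–(1.21) p. 264 («This limit exists by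
the localized representation (1.7)»), (5.10) p. 293.  No claim about the mass gap.
-/

set_option autoImplicit false

noncomputable section

open Filter Topology
open scoped BigOperators Matrix.Norms.L2Operator

namespace YMDAG.N18.WindowedOfLimit

open Literature.MathematicalPhysics.QuantumFieldTheory.Balaban1983to89
open Literature.MathematicalPhysics.QuantumFieldTheory.Balaban1983to89.T4Continuum (T4Family)
open Literature.MathematicalPhysics.QuantumFieldTheory.Balaban1983to89.T4OutputRate (Window DecayBound NE9 mem_window)
open Literature.MathematicalPhysics.QuantumFieldTheory.Balaban1983to89.B12Sec2to5 (l1 Decay510)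
open Literature.MathematicalPhysics.QuantumFieldTheory.Balaban1983to89.FlowStep (Box mem_box)
open Literature.MathematicalPhysics.QuantumFieldTheory.Balaban1983to89.Beta.LimitRate (subKernel subKernel_apply)
open Node00 (TermFamily1 polWindow polLimit PolLimitExists tendsto_polLimit Stage13Params U3Letters₁₁ mergedTermFamilyMatT TβOfRecord₁₃ chiβOfRecord₁₃)
open Node00.U3OfKernels (histPrefix histPrefix_apply kernelA kernelA_eq EA decayBound_EA_iff ne9_EA_iff KernelDecay KernelDecayOfRecord₁₃)
open Node00.U3KernelLetters (KernelStepRate WindowedStepRate WindowedDecay WindowedNE9 PolLimitsExist PolLimitsExistBox KernelStepRateOfRecord₁₃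
  WindowedStepRateOfRecord₁₃ WindowedDecayOfRecord₁₃ WindowedNE9OfRecord₁₃ PolLimitsExistOfRecord₁₃ kernelStepRate_iff_forall_ne5)
open Node00.U3KernelLetters2 (WindowedDecayUniform WindowedDecayUniformOfRecord₁₃)
open YMDAG.N18.KernelStepRateBoxes (decay510_subKernel_of_ne5_family)
open YMDAG.N18.AtRecordOfKernelLetters (kernelStepRate_of_windowed kernelStepRateOfRecord₁₃_of_windowed')

/-! ## §0 ε-room: a convergent sequence is eventually within `ε` of any bound on its limit -/

/-- If `a_K → a` and `|a| ≤ B` then for every `ε > 0` eventually `|a_K| ≤ B + ε`. [folklore] -/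
theorem eventually_abs_le_add_of_tendsto {a : ℕ → ℝ} {A B ε : ℝ} (ha : Tendsto a atTop (𝓝 A)) (hA : |A| ≤ B) (hε : 0 < ε) :
    ∀ᶠ K in atTop, |a K| ≤ B + ε := by
  filter_upwards [Metric.tendsto_nhds.1 ha ε hε] with K hK
  rw [Real.dist_eq] at hK
  calc |a K| = |A + (a K - A)| := by rw [add_sub_cancel]
    _ ≤ |A| + |a K - A| := abs_add_le _ _
    _ ≤ B + ε := add_le_add hA hK.le

/-- If `a_K → a`, `b_K → b` and `|a − b| ≤ C` then for every `ε > 0` and every shift `s` eventually `|a_{K+s} − b_K| ≤ C + ε`. [folklore] -/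
theorem eventually_abs_sub_le_add_of_tendsto {a b : ℕ → ℝ} {A B C ε : ℝ} (ha : Tendsto a atTop (𝓝 A)) (hb : Tendsto b atTop (𝓝 B)) (hAB : |A - B| ≤ C)
    (hε : 0 < ε) (s : ℕ) : ∀ᶠ K in atTop, |a (K + s) - b K| ≤ C + ε := by
  have h : Tendsto (fun K => a (K + s) - b K) atTop (𝓝 (A - B)) := (ha.comp (tendsto_add_atTop_nat s)).sub hb
  exact eventually_abs_le_add_of_tendsto h hAB hε

/-! ## §1 Generic term family: each LIMIT letter + (1.21)-existence ⟹ the WINDOWED letter with any strictly larger constant -/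

section Generic

variable {𝔄 : Type*} [NormedRing 𝔄] [NormedAlgebra ℝ 𝔄]
variable {V : Type*} [NormedAddCommGroup V] [NormedSpace ℝ V] {ι : Type*} [Fintype ι]
variable (F : T4Family) {ℰ : TermFamily1 F 𝔄} (ρ : V →L[ℝ] 𝔄) (bV : Module.Basis ι ℝ V)

/-- ★ **node N18's WINDOWED LETTER FROM ITS LIMIT LETTER + (1.21)-EXISTENCE ON THE BOXES** (converse of dag-n18-w1's `kernelStepRate_of_windowed`): `KernelStepRate F ℰ ρ bV γ κ θ C₅`,
`PolLimitsExistBox F ℰ ρ bV γ`, `0 < θ` and ANY `C₅' > C₅` give `WindowedStepRate F ℰ ρ bV γ s κ θ (C₅'·θ)` at EVERY run offset `s`: per box history `w ∈ ]0, γ]^{k+2}` the limit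
difference is `≤ C₅θ·θ^k·e^{−κ|x|₁}` (dag-n18-w1's box form `decay510_subKernel_of_ne5_family`), both windowed sequences converge (`tendsto_polLimit`), and the room
`(C₅' − C₅)θ^{k+1}e^{−κ|x|₁} > 0` is reached eventually in `K`. [cite: Balaban1987RG1, Thm 1 p.259 and (1.20)–(1.21) p.264 (shape; nothing of the source asserted)] -/
theorem windowedStepRate_of_kernelStepRate_of_polLimitsExistBox {γ κ θ C₅ C₅' : ℝ} (hθ : 0 < θ) (hC : C₅ < C₅')
    (hex : PolLimitsExistBox F ℰ ρ bV γ) (h18 : KernelStepRate F ℰ ρ bV γ κ θ C₅) (s : ℕ) :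
    WindowedStepRate F ℰ ρ bV γ s κ θ (C₅' * θ) := by
  intro k w hw μ ν x
  have hbox := decay510_subKernel_of_ne5_family F ℰ ρ bV ((kernelStepRate_iff_forall_ne5 F ℰ ρ bV γ κ θ C₅).1 h18) k w hw μ ν x
  rw [subKernel_apply] at hbox
  have hA := tendsto_polLimit F (k + 1 + 1) (fun K => ℰ (k + 1) w K) ρ bV (hex (k + 1) w hw) μ ν x
  have hB := tendsto_polLimit F (k + 1) (fun K => ℰ k (Fin.tail w) K) ρ bV (hex k (Fin.tail w) (T4FlagMemory.tail_mem_box hw)) μ ν x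
  have hε : 0 < (C₅' - C₅) * θ * θ ^ k * Real.exp (-κ * l1 x) :=
    mul_pos (mul_pos (mul_pos (sub_pos.2 hC) hθ) (pow_pos hθ k)) (Real.exp_pos _)
  filter_upwards [eventually_abs_sub_le_add_of_tendsto hA hB hbox hε s] with K hK
  calc |polWindow F (K + s) (k + 1 + 1) (ℰ (k + 1) w (K + s)) ρ bV μ ν x - polWindow F K (k + 1) (ℰ k (Fin.tail w) K) ρ bV μ ν x|
      ≤ C₅ * θ * θ ^ k * Real.exp (-κ * l1 x) + (C₅' - C₅) * θ * θ ^ k * Real.exp (-κ * l1 x) := hK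
    _ = C₅' * θ * θ ^ k * Real.exp (-κ * l1 x) := by ring

/-- **node N18's WINDOWED LETTER AT EVERY RUN OFFSET FROM ONE RUN OFFSET** (dag-n18-w1's `kernelStepRate_of_windowed` ∘ the converse above): under (1.21)-existence
on the boxes, `WindowedStepRate … γ s₀ κ θ (C₅·θ)` at ONE offset `s₀` gives `WindowedStepRate … γ s κ θ (C₅'·θ)` at EVERY offset `s`, for every `C₅' > C₅` (`0 < θ`) — the
run-offset letter `s F θ` of the bills is immaterial up to room. [cite: Balaban1987RG1, Thm 1 p.259 and (1.20)–(1.21) p.264 (shape; nothing of the source asserted)] -/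
theorem windowedStepRate_shift_of_polLimitsExistBox {γ κ θ C₅ C₅' : ℝ} (hθ : 0 < θ) (hC : C₅ < C₅') (hex : PolLimitsExistBox F ℰ ρ bV γ) {s₀ : ℕ}
    (hS : WindowedStepRate F ℰ ρ bV γ s₀ κ θ (C₅ * θ)) (s : ℕ) : WindowedStepRate F ℰ ρ bV γ s κ θ (C₅' * θ) :=
  windowedStepRate_of_kernelStepRate_of_polLimitsExistBox F ρ bV hθ hC hex (kernelStepRate_of_windowed F ρ bV s₀ hex hS) s

/-- **W1-19c's UNIFORM WINDOWED LETTER FROM node U3's DECAY SLOT + (1.21)-EXISTENCE** (converse of dag-n18-w1's `decayBound_EA_of_windowedDecayUniform`): `DecayBound (EA F ℰ ρ bV) W E₀ κ`,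
`PolLimitsExist F ℰ ρ bV W` and ANY `E₀' > E₀` give `WindowedDecayUniform F ℰ ρ bV W E₀' κ` (room `(E₀' − E₀)e^{−κ|z|₁} > 0`).
[cite: Balaban1987RG1, (1.18) p.263, (1.21) p.264 and (5.10) p.293 (shape; nothing of the source asserted)] -/
theorem windowedDecayUniform_of_decayBound_of_polLimitsExist {W : Set (ℕ → ℝ)} {E₀ E₀' κ : ℝ} (hE : E₀ < E₀') (hex : PolLimitsExist F ℰ ρ bV W)
    (hU : DecayBound (EA F ℰ ρ bV) W E₀ κ) : WindowedDecayUniform F ℰ ρ bV W E₀' κ := by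
  intro g hg k μ ν z
  have hlim : |polLimit F (k + 1) (fun K => ℰ k (histPrefix g k) K) ρ bV μ ν z| ≤ E₀ * Real.exp (-κ * l1 z) := by
    have h := (decayBound_EA_iff F ℰ ρ bV W E₀ κ).1 hU g hg k μ ν z
    rwa [kernelA_eq] at h
  have hε : 0 < (E₀' - E₀) * Real.exp (-κ * l1 z) := mul_pos (sub_pos.2 hE) (Real.exp_pos _)
  filter_upwards [eventually_abs_le_add_of_tendsto (tendsto_polLimit F (k + 1) _ ρ bV (hex g hg k) μ ν z) hlim hε] with K hK
  calc |polWindow F K (k + 1) (ℰ k (histPrefix g k) K) ρ bV μ ν z| ≤ E₀ * Real.exp (-κ * l1 z) + (E₀' - E₀) * Real.exp (-κ * l1 z) := hK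
    _ = E₀' * Real.exp (-κ * l1 z) := by ring

/-- **W1-19b's PER-SEQUENCE WINDOWED (5.10) LETTER FROM W1-19's (5.10) CLASS + (1.21)-EXISTENCE** (converse of dag-n22-w3's `kernelDecay_of_windowed`): `KernelDecay F ℰ ρ bV W μ ν κ`
(one constant `C₀` per sequence) and `PolLimitsExist F ℰ ρ bV W` give `WindowedDecay F ℰ ρ bV W μ ν κ` with constant `C₀ + 1` per sequence.
[cite: Balaban1987RG1, (1.21) p.264 and (5.10) p.293 (shape; nothing of the source asserted)] -/
theorem windowedDecay_of_kernelDecay_of_polLimitsExist {W : Set (ℕ → ℝ)} {μ ν : Fin 4} {κ : ℝ} (hex : PolLimitsExist F ℰ ρ bV W)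
    (hdec : KernelDecay F ℰ ρ bV W μ ν κ) : WindowedDecay F ℰ ρ bV W μ ν κ := by
  intro g hg
  obtain ⟨C₀, hC₀⟩ := hdec g hg
  refine ⟨C₀ + 1, fun k z => ?_⟩
  have hlim : |polLimit F (k + 1) (fun K => ℰ k (histPrefix g k) K) ρ bV μ ν z| ≤ C₀ * Real.exp (-κ * l1 z) := by
    have h := hC₀ k z
    rwa [kernelA_eq] at h
  have hε : 0 < (1 : ℝ) * Real.exp (-κ * l1 z) := mul_pos one_pos (Real.exp_pos _)
  filter_upwards [eventually_abs_le_add_of_tendsto (tendsto_polLimit F (k + 1) _ ρ bV (hex g hg k) μ ν z) hlim hε] with K hK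
  calc |polWindow F K (k + 1) (ℰ k (histPrefix g k) K) ρ bV μ ν z| ≤ C₀ * Real.exp (-κ * l1 z) + 1 * Real.exp (-κ * l1 z) := hK
    _ = (C₀ + 1) * Real.exp (-κ * l1 z) := by ring

/-- **node N22's WINDOWED NE9 LETTER FROM NE9 OF THE LIMITING KERNELS + (1.21)-EXISTENCE** (converse of dag-n22-w3's `ne9_EA_of_windowed`): `NE9 (EA F ℰ ρ bV) W κ Λ`,
`PolLimitsExist F ℰ ρ bV W` and moduli `Λ'` with `Λ n i < Λ' n i` for all `n i` give `WindowedNE9 F ℰ ρ bV W κ Λ'`.  When the two prefixes agree the windowed kernels are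
EQUAL (they read `histPrefix` only), so the bound is `0 ≤ 0`; otherwise `Σ_{i<k+1} (Λ'−Λ)(k+1) i |g_i − g'_i| > 0` is the room.
[cite: Balaban1987RG1, (1.18) p.263 and (1.20)–(1.21) p.264 (shape; nothing of the source asserted)] -/
theorem windowedNE9_of_ne9_EA_of_polLimitsExist {W : Set (ℕ → ℝ)} {κ : ℝ} {Λ Λ' : ℕ → ℕ → ℝ} (hΛ : ∀ n i, Λ n i < Λ' n i)
    (hex : PolLimitsExist F ℰ ρ bV W) (h9 : NE9 (EA F ℰ ρ bV) W κ Λ) : WindowedNE9 F ℰ ρ bV W κ Λ' := by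
  intro g hg g' hg' k μ ν z
  by_cases hpre : ∀ i ∈ Finset.range (k + 1), g i = g' i
  · -- equal prefixes: the windowed kernels coincide at every `K`, and the modulus vanishes
    have hp : histPrefix g k = histPrefix g' k := funext fun i => hpre i.1 (Finset.mem_range.2 i.2)
    refine Eventually.of_forall fun K => ?_
    have hsum : ∑ i ∈ Finset.range (k + 1), Λ' (k + 1) i * |g i - g' i| = 0 :=
      Finset.sum_eq_zero fun i hi => by rw [hpre i hi, sub_self, abs_zero, mul_zero]
    rw [hp, sub_self, abs_zero, hsum, mul_zero]
  · -- some component of the prefixes differs: the room is positive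
    push Not at hpre
    have hne : ∃ i ∈ Finset.range (k + 1), g i ≠ g' i := hpre
    have hlim : |polLimit F (k + 1) (fun K => ℰ k (histPrefix g k) K) ρ bV μ ν z - polLimit F (k + 1) (fun K => ℰ k (histPrefix g' k) K) ρ bV μ ν z| ≤
        Real.exp (-(κ * l1 z)) * ∑ i ∈ Finset.range (k + 1), Λ (k + 1) i * |g i - g' i| := by
      have h := (ne9_EA_iff F ℰ ρ bV W κ Λ).1 h9 g hg g' hg' k μ ν z
      rwa [kernelA_eq, kernelA_eq] at h
    have hroom : 0 < Real.exp (-(κ * l1 z)) * ∑ i ∈ Finset.range (k + 1), (Λ' (k + 1) i - Λ (k + 1) i) * |g i - g' i| := by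
      refine mul_pos (Real.exp_pos _) (Finset.sum_pos' (fun i _ => mul_nonneg (sub_pos.2 (hΛ _ _)).le (abs_nonneg _)) ?_)
      obtain ⟨i, hi, hne⟩ := hne
      exact ⟨i, hi, mul_pos (sub_pos.2 (hΛ _ _)) (abs_pos.2 (sub_ne_zero.2 hne))⟩
    filter_upwards [eventually_abs_sub_le_add_of_tendsto (tendsto_polLimit F (k + 1) _ ρ bV (hex g hg k) μ ν z)
      (tendsto_polLimit F (k + 1) _ ρ bV (hex g' hg' k) μ ν z) hlim hroom 0] with K hK
    calc |polWindow F K (k + 1) (ℰ k (histPrefix g k) K) ρ bV μ ν z - polWindow F K (k + 1) (ℰ k (histPrefix g' k) K) ρ bV μ ν z|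
        ≤ Real.exp (-(κ * l1 z)) * ∑ i ∈ Finset.range (k + 1), Λ (k + 1) i * |g i - g' i| +
            Real.exp (-(κ * l1 z)) * ∑ i ∈ Finset.range (k + 1), (Λ' (k + 1) i - Λ (k + 1) i) * |g i - g' i| := by simpa using hK
      _ = Real.exp (-(κ * l1 z)) * ∑ i ∈ Finset.range (k + 1), Λ' (k + 1) i * |g i - g' i| := by
        rw [← mul_add, ← Finset.sum_add_distrib]
        congr 1
        exact Finset.sum_congr rfl fun i _ => by ring

/-- **THE LEVEL-0 ROWS OF FILE 6 IN BOTH CURRENCIES, I**: under (1.21)-existence on `W`, FILE 6's WINDOWED level-0 row (constant `E₀`, eventually in the volume) gives its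
LIMIT level-0 row `Decay510 (Π_1(g_0; ·)) E₀ κ` (dag-n22-w3's `decay510_kernelA_of_windowed` at level `0`). [cite: Balaban1987RG1, (1.21) p.264 and (5.10) p.293 (shape)] -/
theorem baseRowLimit_of_baseRow_of_polLimitsExist {W : Set (ℕ → ℝ)} {E₀ κ : ℝ} (hex : PolLimitsExist F ℰ ρ bV W)
    (h0 : ∀ g ∈ W, ∀ (μ ν : Fin 4) (z : Fin 4 → ℤ), ∀ᶠ K in atTop, |polWindow F K 1 (ℰ 0 (histPrefix g 0) K) ρ bV μ ν z| ≤ E₀ * Real.exp (-κ * l1 z)) :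
    ∀ g ∈ W, ∀ (μ ν : Fin 4), Decay510 (kernelA F ℰ ρ bV g 0 μ ν) E₀ κ :=
  fun g hg μ ν => YMDAG.N22.AtKernels.decay510_kernelA_of_windowed F ℰ ρ bV (hex g hg 0) (h0 g hg μ ν)

/-- **THE LEVEL-0 ROWS OF FILE 6 IN BOTH CURRENCIES, II** (room `E₀ < E₀'`): under (1.21)-existence on `W`, FILE 6's LIMIT level-0 row gives back its WINDOWED
level-0 row with any strictly larger constant. [cite: Balaban1987RG1, (1.21) p.264 and (5.10) p.293 (shape)] -/
theorem baseRow_of_baseRowLimit_of_polLimitsExist {W : Set (ℕ → ℝ)} {E₀ E₀' κ : ℝ} (hE : E₀ < E₀') (hex : PolLimitsExist F ℰ ρ bV W)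
    (h0L : ∀ g ∈ W, ∀ (μ ν : Fin 4), Decay510 (kernelA F ℰ ρ bV g 0 μ ν) E₀ κ) :
    ∀ g ∈ W, ∀ (μ ν : Fin 4) (z : Fin 4 → ℤ), ∀ᶠ K in atTop, |polWindow F K 1 (ℰ 0 (histPrefix g 0) K) ρ bV μ ν z| ≤ E₀' * Real.exp (-κ * l1 z) := by
  intro g hg μ ν z
  have hlim : |polLimit F 1 (fun K => ℰ 0 (histPrefix g 0) K) ρ bV μ ν z| ≤ E₀ * Real.exp (-κ * l1 z) := by
    have h := h0L g hg μ ν z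
    rwa [kernelA_eq] at h
  have hε : 0 < (E₀' - E₀) * Real.exp (-κ * l1 z) := mul_pos (sub_pos.2 hE) (Real.exp_pos _)
  filter_upwards [eventually_abs_le_add_of_tendsto (tendsto_polLimit F 1 _ ρ bV (hex g hg 0) μ ν z) hlim hε] with K hK
  calc |polWindow F K 1 (ℰ 0 (histPrefix g 0) K) ρ bV μ ν z| ≤ E₀ * Real.exp (-κ * l1 z) + (E₀' - E₀) * Real.exp (-κ * l1 z) := hK
    _ = E₀' * Real.exp (-κ * l1 z) := by ring

end Generic

/-! ## §2 At the record, Stage 13: the letters OF RECORD, and node N18's two letters of record agree up to room -/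

section Record

variable (F : T4Family) (N : ℕ) [NeZero N]

/-- **node N18's WINDOWED LETTER OF RECORD FROM ITS LIMIT LETTER OF RECORD + (1.21)-EXISTENCE OF RECORD**: `PolLimitsExistOfRecord₁₃ F N θ`,
`KernelStepRateOfRecord₁₃ F N θ κ θ₅ C₅`, `0 < θ₅` and ANY `C₅' > C₅` give `WindowedStepRateOfRecord₁₃ F N θ s κ θ₅ (C₅'·θ₅)` at every run offset `s`.
[cite: Balaban1987RG1, Thm 1 p.259, (1.6) p.261 and (1.20)–(1.21) p.264 (shape; nothing of the record asserted)] -/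
theorem windowedStepRateOfRecord₁₃_of_kernelStepRateOfRecord₁₃ (θ : Stage13Params F N) {κ θ₅ C₅ C₅' : ℝ} (hθ : 0 < θ₅) (hC : C₅ < C₅')
    (hL : PolLimitsExistOfRecord₁₃ F N θ) (h18 : KernelStepRateOfRecord₁₃ F N θ κ θ₅ C₅) (s : ℕ) :
    WindowedStepRateOfRecord₁₃ F N θ s κ θ₅ (C₅' * θ₅) := by
  letI := θ.instVβ₁; letI := θ.instVβ₂; letI := θ.instιβ
  exact windowedStepRate_of_kernelStepRate_of_polLimitsExistBox F θ.ρ8 θ.bV hθ hC hL.box h18 s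

/-- ★ **node N18's TWO LETTERS OF RECORD AGREE UP TO ROOM UNDER (1.21)-EXISTENCE OF RECORD**: windowed at `(s, κ, θ₅, C₅·θ₅)` ⟹ limit at `(κ, θ₅, C₅)` (dag-n18-w1
`kernelStepRateOfRecord₁₃_of_windowed'`), and limit at `(κ, θ₅, C₅)` ⟹ windowed at `(s, κ, θ₅, C₅'·θ₅)` for EVERY `C₅' > C₅` and every `s` (`0 < θ₅`).  The crux's N18 row may be
supplied in either currency. [cite: Balaban1987RG1, Thm 1 p.259 and (1.20)–(1.21) p.264 (shape; nothing of the record asserted)] -/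
theorem kernelStepRateOfRecord₁₃_iff_windowed_upToRoom (θ : Stage13Params F N) {κ θ₅ C₅ : ℝ} (hθ : 0 < θ₅) (hL : PolLimitsExistOfRecord₁₃ F N θ) (s : ℕ) :
    (WindowedStepRateOfRecord₁₃ F N θ s κ θ₅ (C₅ * θ₅) → KernelStepRateOfRecord₁₃ F N θ κ θ₅ C₅) ∧
      (KernelStepRateOfRecord₁₃ F N θ κ θ₅ C₅ → ∀ C₅' : ℝ, C₅ < C₅' → WindowedStepRateOfRecord₁₃ F N θ s κ θ₅ (C₅' * θ₅)) :=
  ⟨fun hS => kernelStepRateOfRecord₁₃_of_windowed' F N θ s hL hS,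
    fun h18 _ hC => windowedStepRateOfRecord₁₃_of_kernelStepRateOfRecord₁₃ F N θ hθ hC hL h18 s⟩

/-- **W1-19c's UNIFORM LETTER OF RECORD FROM A UNIFORM (5.10) CLASS OF THE LIMITING KERNELS OF RECORD + (1.21)-EXISTENCE** (room `E₀ < E₀'`).
[cite: Balaban1987RG1, (1.18) p.263, (1.21) p.264 and (5.10) p.293 (shape; nothing of the record asserted)] -/
theorem windowedDecayUniformOfRecord₁₃_of_kernelDecayUniform (θ : Stage13Params F N) {E₀ E₀' κ : ℝ} (hE : E₀ < E₀') (hL : PolLimitsExistOfRecord₁₃ F N θ)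
    (hU : letI := θ.instVβ₁; letI := θ.instVβ₂; letI := θ.instιβ
      DecayBound (EA F (mergedTermFamilyMatT F N (TβOfRecord₁₃ F N) (chiβOfRecord₁₃ F N θ) θ.εbg) θ.ρ8 θ.bV) (Window θ.γ) E₀ κ) :
    WindowedDecayUniformOfRecord₁₃ F N θ E₀' κ := by
  letI := θ.instVβ₁; letI := θ.instVβ₂; letI := θ.instιβ
  exact windowedDecayUniform_of_decayBound_of_polLimitsExist F θ.ρ8 θ.bV hE hL hU

/-- **THE BILL's (D4) ROW CURRENCY**: W1-19's (5.10) class of record `KernelDecayOfRecord₁₃ F N θ μ ν κ` (dag-n27-c's `hdec` at `(0,1)`) + `PolLimitsExistOfRecord₁₃` give W1-19b's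
windowed letter of record `WindowedDecayOfRecord₁₃ F N θ μ ν κ` (dag-n27-w1's `hW` at `(0,1)`) — converse of dag-n22-w3's `kernelDecayOfRecord₁₃_of_windowed`.
[cite: Balaban1987RG1, (1.21) p.264 and (5.10) p.293 (shape; nothing of the record asserted)] -/
theorem windowedDecayOfRecord₁₃_of_kernelDecayOfRecord₁₃ (θ : Stage13Params F N) {μ ν : Fin 4} {κ : ℝ} (hL : PolLimitsExistOfRecord₁₃ F N θ)
    (hdec : KernelDecayOfRecord₁₃ F N θ μ ν κ) : WindowedDecayOfRecord₁₃ F N θ μ ν κ := by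
  letI := θ.instVβ₁; letI := θ.instVβ₂; letI := θ.instιβ
  exact windowedDecay_of_kernelDecay_of_polLimitsExist F θ.ρ8 θ.bV hL hdec

/-- **node N22's WINDOWED LETTER OF RECORD FROM NE9 OF THE LIMITING KERNELS OF RECORD + (1.21)-EXISTENCE** (moduli room `Λ < Λ'` pointwise).
[cite: Balaban1987RG1, (1.18) p.263 and (1.20)–(1.21) p.264 (shape; nothing of the record asserted)] -/
theorem windowedNE9OfRecord₁₃_of_ne9 (θ : Stage13Params F N) {κ : ℝ} {Λ Λ' : ℕ → ℕ → ℝ} (hΛ : ∀ n i, Λ n i < Λ' n i) (hL : PolLimitsExistOfRecord₁₃ F N θ)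
    (h9 : letI := θ.instVβ₁; letI := θ.instVβ₂; letI := θ.instιβ
      NE9 (EA F (mergedTermFamilyMatT F N (TβOfRecord₁₃ F N) (chiβOfRecord₁₃ F N θ) θ.εbg) θ.ρ8 θ.bV) (Window θ.γ) κ Λ) :
    WindowedNE9OfRecord₁₃ F N θ κ Λ' := by
  letI := θ.instVβ₁; letI := θ.instVβ₂; letI := θ.instιβ
  exact windowedNE9_of_ne9_EA_of_polLimitsExist F θ.ρ8 θ.bV hΛ hL h9

end Record

end YMDAG.N18.WindowedOfLimit

end
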